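import Literature.AlgebraicGeometry.Modules.IdealMul
import Literature.AlgebraicGeometry.Modules.PushforwardTrace
import Literature.AlgebraicGeometry.Modules.PushforwardClosedImmersionCoh
import Literature.AlgebraicGeometry.Modules.LocalExactness
import Literature.AlgebraicGeometry.Modules.IsoOfSectionsOnBasis
import Mathlib.AlgebraicGeometry.Morphisms.ClosedImmersion
import HarnessLib

/-!
# The ideal sheaf `𝓘_Z ⊆ 𝒪_X` of a closed immersion `ι : Z → X` as an `𝒪_X`-module

The Stacks Project, Tag 01QN (Morphisms, Section 29.2: "Given a closed immersion `i : Z → X`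
the *ideal sheaf of* `Z` is the kernel `𝓘 = Ker(𝒪_X → i_*𝒪_Z)` … we get a short exact sequence
`0 → 𝓘 → 𝒪_X → i_*𝒪_Z → 0` of `𝒪_X`-modules") / Hartshorne II Prop. 5.9 (p. 116: for a closed
subscheme `Y` of `X` with ideal sheaf `𝓘_Y`, "`𝓘_Y` is a quasi-coherent sheaf of ideals on `X`
[coherent if `X` is noetherian] … `𝒪_X/𝓘_Y ≅ i_*𝒪_Y`"). Mathlib records the ideal sheaf of a
morphism `ι : Z → X` as AFFINE DATA `ι.ker : X.IdealSheafData` (`Scheme.Hom.ker`, ideals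
`ker ι♯_V ⊆ Γ(V, 𝒪_X)` on the affine opens, `Scheme.Hom.ker_apply`); this file turns it into the
`𝒪_X`-MODULE `𝓘_Z` by the tree's `𝒥M ⊆ M` construction (`Modules/IdealMul`, one line:
`idealMul (unitModule X) ι.ker`), so that the whole `IdealMul` API — coherence, the quotient
`𝒪_X/𝓘_Z = idealQuot`, modules killed by `𝓘_Z`, the sections formula on affine opens — applies to
it verbatim, and proves the defining short exact sequence with the tree's algebra unit
`ι♯ : 𝒪_X → ι_*𝒪_Z` (`Modules/PushforwardTrace.algebraUnit`; by
`Modules/PullbackAlgebraUnit.algebraUnit_eq_unitToPushforwardObjUnit` this is Mathlib's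
`SheafOfModules.unitToPushforwardObjUnit ι.toRingCatSheafHom`).

* `isKilledBy_ker_pushforward` — for ANY morphism `ι`, every direct image `ι_*P` is killed by
  `ι.ker` (`Γ(V, 𝒪_X)` acts on `Γ(V, ι_*P) = Γ(ι⁻¹V, P)` through `ι♯_V`, and
  `ι.ker(V) ≤ ker ι♯_V`, Mathlib `Scheme.Hom.ideal_ker_le`);
* `idealSheafOf ι = 𝓘_Z := 𝓘·𝒪_X ⊆ 𝒪_X` with its inclusion `idealSheafOfι ι` (a monomorphism),
  affine-localizing, coherent for `X` locally noetherian (`coh_idealSheafOf`); the sections of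
  `𝓘_Z` over an affine `V` are exactly `ι.ker(V)` (`idealSheafOfι_app_mem`), hence for `ι`
  quasi-compact exactly `ker (ι♯_V : Γ(V, 𝒪_X) → Γ(ι⁻¹V, 𝒪_Z))`, and over ANY open `V` a function
  is a section of `𝓘_Z` iff `ι♯_V` kills it (`exists_idealSheafOfι_app_eq_iff`);
  `idealSheafOf_subschemeι : 𝓘_{V(I)} = I·𝒪_X` for Mathlib's closed subscheme `I.subschemeι` of an
  ideal sheaf `I` (`ker_subschemeι`);
* `idealSheafOfι_comp_algebraUnit : 𝓘_Z → 𝒪_X → ι_*𝒪_Z` is zero (any `ι`),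
  `exact_idealSheafOfι_algebraUnit` (for `ι` quasi-compact), `epi_algebraUnit` and
  **`shortExact_idealSheafOf`: `0 → 𝓘_Z → 𝒪_X → ι_*𝒪_Z → 0` is short exact for a closed
  immersion `ι`** (`ι♯_V` is surjective on affine `V`, Mathlib `Scheme.Hom.app_surjective`);
* consequences: **`idealQuotIsoPushforwardUnit : 𝒪_X/𝓘_Z ≅ ι_*𝒪_Z`** compatibly with the two
  projections, and `idealSheafOfIsoKernel : 𝓘_Z ≅ ker(ι♯)` compatibly with the two inclusions —
  the bridge to the kernel form `Literature.AlgebraicGeometry.Deformation.idealModule`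
  (`Deformation/SquareZeroExtensionObstruction`, `kernel (unitToPushforwardObjUnit _)`), which is
  not imported here (it imports all of Mathlib).

Everything is proved; no named facts, no instances, no notation. Mathlib searched (pin v4.32):
`Scheme.Hom.ker`, `Hom.ideal_ker_le`, `Hom.ker_apply`, `IdealSheafData.ker_subschemeι`,
`Scheme.Hom.app_surjective`, `IsAffineHom → QuasiCompact` (used); Mathlib has no ideal sheaf of a
closed immersion as an object of `Scheme.Modules` and no `𝒪_X/𝓘 ≅ i_*𝒪_Z`.
What is NOT here: `ι^*𝓘_Z = 𝓘/𝓘²` (the conormal sheaf), powers `𝓘ⁿ`, the correspondence closed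
subschemes ↔ quasi-coherent ideals (Mathlib `IdealSheafData.subscheme`), finite locally free
resolutions of `𝓘_Z` (`Modules/StrictlyPerfectResolutionExists`).

## References

* The Stacks Project, Tag 01QN (Morphisms, Section 29.2, closed immersions and their ideal
  sheaves), Tag 08KS (Modules, Lemma 17.13.4: `i_*i^*𝓕 = 𝓕/𝓘𝓕`), Tag 01QY. [StacksProject]
* R. Hartshorne, *Algebraic Geometry*, GTM 52 (1977), II Prop. 5.9 (p. 116) and the definition of
  the ideal sheaf of a closed subscheme preceding it (p. 115). [Hartshorne1977]
* U. Görtz, T. Wedhorn, *Algebraic Geometry I*, 2nd ed. (2020), Prop. 7.34 / (7.15).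
  [GortzWedhorn2020]
-/

noncomputable section

-- `TopCat.Presheaf`/`Scheme.Modules` are not reducible (as in Mathlib's `AlgebraicGeometry/Modules`).
set_option backward.isDefEq.respectTransparency false

open CategoryTheory AlgebraicGeometry Limits TopologicalSpace Opposite

universe u

namespace Literature.AlgebraicGeometry.Modules

open Literature.AlgebraicGeometry.Morphisms

variable {Z X : Scheme.{u}} (ι : Z ⟶ X)

/-! ## Direct images are killed by the kernel ideal -/

/-- **`ι.ker · ι_*P = 0`**: for any morphism `ι : Z → X` and any `𝒪_Z`-module `P`, the direct image
`ι_*P` is killed by the kernel ideal sheaf `ι.ker` (on an affine `V`, `r ∈ ι.ker(V)` has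
`ι♯_V(r) = 0`, Mathlib `Scheme.Hom.ideal_ker_le`, and `r` acts on `Γ(V, ι_*P) = Γ(ι⁻¹V, P)` as
`ι♯_V(r)`). [cite: StacksProject, Tag 08KS (Modules, Lemma 17.13.4: the essential image of `i_*` is killed by `𝓘`)] -/
theorem isKilledBy_ker_pushforward (P : Z.Modules) :
    IsKilledBy ι.ker ((Scheme.Modules.pushforward ι).obj P) := by
  intro V r hr s
  rw [pushforward_smul]
  have h0 : ι.app V r = 0 := ι.ideal_ker_le V hr
  rw [h0, zero_smul]

/-! ## The ideal sheaf `𝓘_Z` as a module -/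

/-- **The ideal sheaf `𝓘_Z ⊆ 𝒪_X` of `ι : Z → X` as an `𝒪_X`-module**: the submodule `𝓘·𝒪_X` of
the structure sheaf generated by the kernel ideal sheaf `𝓘 = ι.ker` (the tree's `idealMul`; its
sections over an affine `V` are `ι.ker(V) = ker ι♯_V`, `idealSheafOfι_app_mem`,
`exists_idealSheafOfι_app_eq_iff`). For a closed immersion this is the kernel of
`ι♯ : 𝒪_X → ι_*𝒪_Z` (`idealSheafOfIsoKernel`, `shortExact_idealSheafOf`).
[cite: StacksProject, Tag 01QN (Morphisms, Section 29.2)] [cite: Hartshorne1977, II Prop. 5.9 (p. 116)] -/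
abbrev idealSheafOf : X.Modules :=
  idealMul (unitModule X) ι.ker

/-- The inclusion `𝓘_Z ⟶ 𝒪_X`. [cite: StacksProject, Tag 01QN] -/
abbrev idealSheafOfι : idealSheafOf ι ⟶ unitModule X :=
  idealMulι (unitModule X) ι.ker

/-- `𝓘_Z ⟶ 𝒪_X` is a monomorphism. [cite: StacksProject, Tag 01QN (Morphisms, Section 29.2)] -/
theorem mono_idealSheafOfι : Mono (idealSheafOfι ι) :=
  inferInstance

/-- `𝓘_Z ⟶ 𝒪_X` is injective on sections. [cite: StacksProject, Tag 01QN (Morphisms, Section 29.2)] -/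
theorem idealSheafOfι_app_injective (U : X.Opens) : Function.Injective ((idealSheafOfι ι).app U) :=
  idealMulι_app_injective _ _ U

/-- **`𝓘_Z` is affine-localizing** (quasi-coherent in the tree's sense). [cite: Hartshorne1977, II Prop. 5.9 (p. 116)] -/
theorem isAffineLocalizing_idealSheafOf : IsAffineLocalizing (idealSheafOf ι) :=
  isAffineLocalizing_idealMul IsAffineLocalizing.unit

/-- **`𝓘_Z` is coherent** for `X` locally noetherian. [cite: Hartshorne1977, II Prop. 5.9 (p. 116)] -/
theorem coh_idealSheafOf [IsLocallyNoetherian X] : Coh (idealSheafOf ι) :=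
  coh_idealMul _ ⟨IsAffineLocalizing.unit, IsAffineFiniteType.unit⟩

/-- For Mathlib's closed subscheme `V(I) ↪ X` of an ideal sheaf `I`, the ideal sheaf module is
`I·𝒪_X` (Mathlib `IdealSheafData.ker_subschemeι : (I.subschemeι).ker = I`). [cite: StacksProject, Tag 01QN (Morphisms, Section 29.2)] -/
theorem idealSheafOf_subschemeι (I : X.IdealSheafData) :
    idealSheafOf I.subschemeι = idealMul (unitModule X) I := by
  change idealMul (unitModule X) I.subschemeι.ker = idealMul (unitModule X) I
  rw [Scheme.IdealSheafData.ker_subschemeι]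

/-! ## Sections of `𝓘_Z` -/

/-- In `Γ(V, 𝒪_X)` regarded as a module over itself, `J • ⊤ = J`: membership in `J(V)·Γ(V, 𝒪_X)`
is membership in `J(V)`. [folklore] -/
private theorem mem_ideal_smul_top_unit_iff (J : X.IdealSheafData) (V : X.affineOpens)
    (s : Γ(unitModule X, V)) :
    s ∈ J.ideal V • (⊤ : Submodule Γ(X, V) Γ(unitModule X, V)) ↔ (s : Γ(X, V)) ∈ J.ideal V := by
  constructor
  · intro hs
    refine Submodule.smul_induction_on (p := fun m => (m : Γ(X, V)) ∈ J.ideal V) hs ?_ ?_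
    · intro r hr m _
      exact Ideal.mul_mem_right (m : Γ(X, V)) _ hr
    · intro a b ha hb
      exact Ideal.add_mem _ ha hb
  · intro hs
    have h1 : (s : Γ(X, V)) • (show Γ(unitModule X, V) from (1 : Γ(X, V))) = s :=
      mul_one (show Γ(X, V) from s)
    rw [← h1]
    exact Submodule.smul_mem_smul hs trivial

/-- **Sections of `𝓘_Z` over an affine `V` lie in `ι.ker(V)`** (`Γ(V, 𝓘·𝒪_X) = 𝓘(V)·Γ(V, 𝒪_X)`,
`Modules/IdealMul.idealMulι_app_mem`). [cite: GortzWedhorn2020, Prop. 7.14 (p. 186)] -/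
theorem idealSheafOfι_app_mem {V : X.Opens} (hV : IsAffineOpen V) (m : Γ(idealSheafOf ι, V)) :
    ((idealSheafOfι ι).app V m : Γ(X, V)) ∈ ι.ker.ideal ⟨V, hV⟩ :=
  (mem_ideal_smul_top_unit_iff ι.ker ⟨V, hV⟩ _).mp (idealMulι_app_mem IsAffineLocalizing.unit hV m)

/-- Conversely an element of `ι.ker(V)`, `V` affine, is a section of `𝓘_Z`. [cite: GortzWedhorn2020, Prop. 7.14 (p. 186)] -/
theorem exists_idealSheafOfι_app_eq_of_mem {V : X.Opens} (hV : IsAffineOpen V) (s : Γ(unitModule X, V))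
    (hs : (s : Γ(X, V)) ∈ ι.ker.ideal ⟨V, hV⟩) :
    ∃ m : Γ(idealSheafOf ι, V), (idealSheafOfι ι).app V m = s :=
  exists_idealMulι_app_eq _ _ s
    (isIdealMulSection_of_mem hV ((mem_ideal_smul_top_unit_iff ι.ker ⟨V, hV⟩ s).mpr hs))

/-! ## The complex `𝓘_Z → 𝒪_X → ι_*𝒪_Z` -/

/-- **`𝓘_Z → 𝒪_X → ι_*𝒪_Z` is zero** (any `ι`): `ι_*𝒪_Z` is killed by `ι.ker`
(`isKilledBy_ker_pushforward`) and a morphism to a module killed by `𝓘` kills `𝓘·𝒪_X`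
(`Modules/IdealMul.idealMulι_comp_eq_zero`). [cite: StacksProject, Tag 01QN] -/
@[reassoc]
theorem idealSheafOfι_comp_algebraUnit : idealSheafOfι ι ≫ algebraUnit ι = 0 :=
  idealMulι_comp_eq_zero (isKilledBy_ker_pushforward ι (unitModule Z)) (algebraUnit ι)

/-- On sections: `ι♯_V` kills every section of `𝓘_Z` over any open `V`. [cite: StacksProject, Tag 01QN] -/
theorem app_idealSheafOfι_app (V : X.Opens) (m : Γ(idealSheafOf ι, V)) :
    ι.app V ((idealSheafOfι ι).app V m : Γ(X, V)) = 0 := by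
  have h := congrArg (fun φ => φ.app V m) (idealSheafOfι_comp_algebraUnit ι)
  change (algebraUnit ι).app V ((idealSheafOfι ι).app V m) = (0 : idealSheafOf ι ⟶ _).app V m at h
  rw [algebraUnit_app_apply] at h
  exact h

/-- The short complex `𝓘_Z → 𝒪_X → ι_*𝒪_Z`. [cite: StacksProject, Tag 01QN] -/
abbrev idealSheafShortComplex : ShortComplex X.Modules :=
  ShortComplex.mk (idealSheafOfι ι) (algebraUnit ι) (idealSheafOfι_comp_algebraUnit ι)

/-- **A function killed by `ι♯_V` is a section of `𝓘_Z`** (`ι` quasi-compact, e.g. a closed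
immersion; any open `V`): locally on affine `W ⊆ V`, `s|_W ∈ ker ι♯_W = ι.ker(W)` (Mathlib
`Scheme.Hom.ker_apply`), so `s` is a product section. [cite: StacksProject, Tag 01QN] -/
theorem exists_idealSheafOfι_app_eq [QuasiCompact ι] (V : X.Opens) (s : Γ(unitModule X, V))
    (hs : ι.app V (s : Γ(X, V)) = 0) :
    ∃ m : Γ(idealSheafOf ι, V), (idealSheafOfι ι).app V m = s := by
  refine exists_idealMulι_app_eq _ _ s fun x hx => ?_
  obtain ⟨W, hW, hxW, hWV⟩ := Opens.isBasis_iff_nbhd.mp X.isBasis_affineOpens hx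
  refine ⟨⟨W, hW⟩, hWV, hxW, ?_⟩
  rw [mem_ideal_smul_top_unit_iff, Scheme.Hom.ker_apply]
  change ι.app W (X.presheaf.map (homOfLE hWV).op s) = 0
  have hnat := ConcreteCategory.congr_hom (ι.naturality (homOfLE hWV).op) s
  change ι.app W (X.presheaf.map (homOfLE hWV).op s) =
    Z.presheaf.map ((Opens.map ι.base).map (homOfLE hWV)).op (ι.app V s) at hnat
  rw [hnat, hs, map_zero]

/-- **Sections of `𝓘_Z` over any open `V` are exactly the functions killed by `ι♯_V`**
(`ι` quasi-compact). [cite: StacksProject, Tag 01QN] [cite: Hartshorne1977, II Prop. 5.9 (p. 116)] -/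
theorem exists_idealSheafOfι_app_eq_iff [QuasiCompact ι] (V : X.Opens) (s : Γ(unitModule X, V)) :
    (∃ m : Γ(idealSheafOf ι, V), (idealSheafOfι ι).app V m = s) ↔ ι.app V (s : Γ(X, V)) = 0 := by
  refine ⟨?_, exists_idealSheafOfι_app_eq ι V s⟩
  rintro ⟨m, rfl⟩
  exact app_idealSheafOfι_app ι V m

/-- **`𝓘_Z → 𝒪_X → ι_*𝒪_Z` is exact** for `ι` quasi-compact (local exactness criterion
`Modules/LocalExactness.exact_of_locally_exact`). [cite: StacksProject, Tag 01QN] -/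
theorem exact_idealSheafOfι_algebraUnit [QuasiCompact ι] : (idealSheafShortComplex ι).Exact := by
  refine exact_of_locally_exact _ fun V s hs x hx => ?_
  change (algebraUnit ι).app V s = 0 at hs
  rw [algebraUnit_app_apply] at hs
  obtain ⟨m, hm⟩ := exists_idealSheafOfι_app_eq ι V s hs
  refine ⟨V, 𝟙 V, hx, m, ?_⟩
  change (idealSheafOfι ι).app V m = (unitModule X).presheaf.map (𝟙 V).op s
  rw [op_id, CategoryTheory.Functor.map_id]
  exact hm

/-! ## The short exact sequence `0 → 𝓘_Z → 𝒪_X → ι_*𝒪_Z → 0` of a closed immersion -/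

/-- **`ι♯ : 𝒪_X → ι_*𝒪_Z` is an epimorphism for a closed immersion** (surjective on every affine
open, Mathlib `Scheme.Hom.app_surjective`). [cite: StacksProject, Tag 01QN] -/
theorem epi_algebraUnit [IsClosedImmersion ι] : Epi (algebraUnit ι) :=
  epi_of_surjective_app_of_isAffineOpen _ fun V hV s => by
    obtain ⟨t, ht⟩ := ι.app_surjective V hV s
    exact ⟨t, ht⟩

/-- **`0 → 𝓘_Z → 𝒪_X → ι_*𝒪_Z → 0` is a short exact sequence of `𝒪_X`-modules for a closed
immersion `ι : Z → X`.** [cite: StacksProject, Tag 01QN (Morphisms, Section 29.2)] [cite: Hartshorne1977, II Prop. 5.9 (p. 116)] -/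
theorem shortExact_idealSheafOf [IsClosedImmersion ι] : (idealSheafShortComplex ι).ShortExact :=
  ShortComplex.ShortExact.mk' (exact_idealSheafOfι_algebraUnit ι) (mono_idealSheafOfι ι)
    (epi_algebraUnit ι)

/-! ## Consequences: `𝒪_X/𝓘_Z ≅ ι_*𝒪_Z` and `𝓘_Z ≅ ker ι♯` -/

section Consequences

variable [IsClosedImmersion ι]

/-- **`𝒪_X/𝓘_Z ≅ ι_*𝒪_Z`** for a closed immersion: both are cokernels of `𝓘_Z → 𝒪_X` (the
tree's `idealQuot (unitModule X) ι.ker = coker(𝓘·𝒪_X → 𝒪_X)` and the short exact sequence).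
[cite: Hartshorne1977, II Prop. 5.9 (p. 116): `𝒪_X/𝓘_Y ≅ i_*𝒪_Y`] [cite: StacksProject, Tag 01QN] -/
def idealQuotIsoPushforwardUnit :
    idealQuot (unitModule X) ι.ker ≅ (Scheme.Modules.pushforward ι).obj (unitModule Z) :=
  haveI : Epi (idealSheafShortComplex ι).g := epi_algebraUnit ι
  IsColimit.coconePointUniqueUpToIso (cokernelIsCokernel (idealSheafOfι ι))
    (exact_idealSheafOfι_algebraUnit ι).gIsCokernel

/-- Compatibility with the projections: `(𝒪_X → 𝒪_X/𝓘_Z) ≫ ≅ = ι♯`. [cite: Hartshorne1977, II Prop. 5.9 (p. 116)] -/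
@[reassoc (attr := simp)]
theorem idealQuotπ_idealQuotIsoPushforwardUnit_hom :
    idealQuotπ (unitModule X) ι.ker ≫ (idealQuotIsoPushforwardUnit ι).hom = algebraUnit ι :=
  IsColimit.comp_coconePointUniqueUpToIso_hom (cokernelIsCokernel (idealSheafOfι ι)) _
    WalkingParallelPair.one

/-- Equivalently `ι♯ ≫ ≅⁻¹ = (𝒪_X → 𝒪_X/𝓘_Z)`. [cite: Hartshorne1977, II Prop. 5.9 (p. 116)] -/
@[reassoc (attr := simp)]
theorem algebraUnit_idealQuotIsoPushforwardUnit_inv :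
    algebraUnit ι ≫ (idealQuotIsoPushforwardUnit ι).inv = idealQuotπ (unitModule X) ι.ker := by
  rw [← idealQuotπ_idealQuotIsoPushforwardUnit_hom ι, Category.assoc, Iso.hom_inv_id, Category.comp_id]

/-- On sections: the isomorphism `𝒪_X/𝓘_Z ≅ ι_*𝒪_Z` sends the class of a function `s ∈ Γ(V, 𝒪_X)`
to `ι♯_V(s) ∈ Γ(ι⁻¹V, 𝒪_Z)`. [cite: Hartshorne1977, II Prop. 5.9 (p. 116)] -/
theorem idealQuotIsoPushforwardUnit_hom_app_apply (V : X.Opens) (s : Γ(unitModule X, V)) :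
    (idealQuotIsoPushforwardUnit ι).hom.app V ((idealQuotπ (unitModule X) ι.ker).app V s) =
      ι.app V (s : Γ(X, V)) := by
  change (idealQuotπ (unitModule X) ι.ker ≫ (idealQuotIsoPushforwardUnit ι).hom).app V s = _
  rw [idealQuotπ_idealQuotIsoPushforwardUnit_hom, algebraUnit_app_apply]

end Consequences

/-- **`𝓘_Z ≅ ker(ι♯ : 𝒪_X → ι_*𝒪_Z)`** for `ι` quasi-compact (e.g. a closed immersion): both are
kernels of `ι♯`. Since `algebraUnit ι = SheafOfModules.unitToPushforwardObjUnit ι.toRingCatSheafHom`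
(`Modules/PullbackAlgebraUnit.algebraUnit_eq_unitToPushforwardObjUnit`), this identifies `𝓘_Z`
with the kernel-form ideal module `Literature.AlgebraicGeometry.Deformation.idealModule ι`.
[cite: StacksProject, Tag 01QN: `𝓘 = Ker(𝒪_X → i_*𝒪_Z)`] -/
def idealSheafOfIsoKernel [QuasiCompact ι] : idealSheafOf ι ≅ kernel (algebraUnit ι) :=
  haveI : Mono (idealSheafShortComplex ι).f := mono_idealSheafOfι ι
  IsLimit.conePointUniqueUpToIso (exact_idealSheafOfι_algebraUnit ι).fIsKernel
    (limit.isLimit (parallelPair (algebraUnit ι) 0))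

/-- Compatibility with the inclusions: `≅ ≫ ker.ι = (𝓘_Z → 𝒪_X)`. [cite: StacksProject, Tag 01QN (Morphisms, Section 29.2)] -/
@[reassoc (attr := simp)]
theorem idealSheafOfIsoKernel_hom_ι [QuasiCompact ι] :
    (idealSheafOfIsoKernel ι).hom ≫ kernel.ι (algebraUnit ι) = idealSheafOfι ι :=
  IsLimit.conePointUniqueUpToIso_hom_comp (exact_idealSheafOfι_algebraUnit ι).fIsKernel
    (limit.isLimit (parallelPair (algebraUnit ι) 0)) WalkingParallelPair.zero

/-- Equivalently `≅⁻¹ ≫ (𝓘_Z → 𝒪_X) = ker.ι`. [cite: StacksProject, Tag 01QN (Morphisms, Section 29.2)] -/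
@[reassoc (attr := simp)]
theorem idealSheafOfIsoKernel_inv_ι [QuasiCompact ι] :
    (idealSheafOfIsoKernel ι).inv ≫ idealSheafOfι ι = kernel.ι (algebraUnit ι) := by
  rw [← idealSheafOfIsoKernel_hom_ι ι, Iso.inv_hom_id_assoc]

/-! ## The quotient `𝒪_X/𝓘_Z` and modules killed by `𝓘_Z` -/

/-- `ι_*𝒪_Z` is coherent for a closed immersion into a locally noetherian scheme (`Z` is then
locally noetherian and `ι` is finite; `Modules/PushforwardClosedImmersionCoh`). [cite: Hartshorne1977, II Ex. 5.5 (p. 124)] -/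
theorem coh_pushforward_unit [IsClosedImmersion ι] [IsLocallyNoetherian X] :
    Coh ((Scheme.Modules.pushforward ι).obj (unitModule Z)) := by
  have h := coh_idealQuot ι.ker (⟨IsAffineLocalizing.unit, IsAffineFiniteType.unit⟩ : Coh (unitModule X))
  exact ⟨IsAffineLocalizing.of_iso (idealQuotIsoPushforwardUnit ι) h.loc,
    IsAffineFiniteType.of_iso (idealQuotIsoPushforwardUnit ι) h.ft⟩

/-- **A module killed by `𝓘_Z` is killed by `𝓘_Z → 𝒪_X`**: every morphism `𝒪_X → N` to a module
`N` with `ι.ker · N = 0` (e.g. any direct image `ι_*P`, `isKilledBy_ker_pushforward`) factors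
uniquely through `ι♯ : 𝒪_X → ι_*𝒪_Z` (`ι` a closed immersion). [cite: StacksProject, Tag 01QY] -/
theorem existsUnique_algebraUnit_desc [IsClosedImmersion ι] {N : X.Modules} (hN : IsKilledBy ι.ker N)
    (φ : unitModule X ⟶ N) :
    ∃! ψ : (Scheme.Modules.pushforward ι).obj (unitModule Z) ⟶ N, algebraUnit ι ≫ ψ = φ := by
  haveI := epi_algebraUnit ι
  refine ⟨(idealQuotIsoPushforwardUnit ι).inv ≫ idealQuotDesc hN φ, ?_, fun ψ hψ => ?_⟩
  · change algebraUnit ι ≫ (idealQuotIsoPushforwardUnit ι).inv ≫ idealQuotDesc hN φ = φ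
    rw [algebraUnit_idealQuotIsoPushforwardUnit_inv_assoc, idealQuotπ_desc]
  · rw [← cancel_epi (algebraUnit ι), hψ, algebraUnit_idealQuotIsoPushforwardUnit_inv_assoc,
      idealQuotπ_desc]

end Literature.AlgebraicGeometry.Modules

end
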